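import Summits.QuantumFields.YangMills.Theses.FixedTorusFirst
import Summits.QuantumFields.YangMills.Theorems.FixedTorusFirstTorusHankelCeiling
import Summits.QuantumFields.YangMills.Theorems.FixedTorusFirstTorusHankelLongitudinal
import Summits.QuantumFields.YangMills.Theorems.FixedTorusFirstSomeTorusDetector
import Summits.QuantumFields.YangMills.Theorems.FixedTorusFirstAssembly

/-!
# Route `FixedTorusFirst`: the crux `SomeTorusFloors` (stmt-QuantumFields-27354) FROM the two remaining cruxes of
LINE g11-2 «engine tori» — `SomeTorusEdgeBit` (24174) and the residual `SkewOnSomeTorus` (24178)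

Ideator seat ym-idea-8 g11 (lens «dual»).  All three support items of the line are now in the tree BY NAME:
`TorusHankelCeiling` (`fixedTorusFirst_torusHankelCeiling`, p704149), `TorusHankelLongitudinal`
(`fixedTorusFirst_torusHankelLongitudinal`, p704218) and `SomeTorusDetector` (`Theorems.fixedTorusFirst_someTorusDetector_proof`,
p708347 — blind sequential extraction p707587 ★ ym-spine-19353-p1, blind rigidity p705845 ym-line-sfw-p2-w4, compact-support
transfer p707314 and composition p707923 this seat).  Hence the route's rank-2 crux `SomeTorusFloors` (floors (i) and (ii) on SOME
torus per physical size) follows from the UV engine bit on the engine tori and the clause-(ii) residual alone — this is the inner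
`?_` of the route's certified `closes` (rev 1, commit ca4f807b34ad), moved Theorems-side so that the ledger census can count
27354 as «= 24174 + 24178», nothing more:

  `someTorusFloors_of_cruxes : SomeTorusEdgeBit → SkewOnSomeTorus → SomeTorusFloors`.

With the route's landed `Assembly` (`Theorems.fixedTorusFirst_assembly` : `SomeTorusFloors → FiniteSizeInsensitivity → NT`)
this gives `NT` from exactly {24174, 24178, 27355} (`nt_of_cruxes` below) — an implication only.

HONEST LABEL: no crux is proved here; `SomeTorusEdgeBit` (UV engine node, = 24146 restricted to engine tori),
`SkewOnSomeTorus` (NT clause (ii) residual) and `FiniteSizeInsensitivity` (IR) are OPEN; `NT`, rung R2a and the Yang–Mills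
mass gap are NOT proved.
-/

set_option autoImplicit false

namespace Summit.QuantumFields.YangMills.Cruxes.FixedTorusFirstEngineTori

open Summit.QuantumFields.YangMills.Theses.FixedTorusFirst
open MeasureTheory

/-- **`SomeTorusEdgeBit → SkewOnSomeTorus → SomeTorusFloors`** (crux 27354 from cruxes 24174 + 24178, the three supports
plugged in by name). -/
theorem someTorusFloors_of_cruxes (hB : SomeTorusEdgeBit) (hS : SkewOnSomeTorus) : SomeTorusFloors := by
  intro G _ _ _ _ hG
  letI : MeasurableSpace G := borel G
  haveI : BorelSpace G := ⟨rfl⟩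
  obtain ⟨r, a, Lsel, ha, hlim, hgrow, hEdge, hN⟩ := hB G hG
  -- RP supports along the engine tori: EDGE_T ⇒ BDD6_T ⇒ LONG6_T (landed)
  have hBdd := fixedTorusFirst_torusHankelCeiling G hG r a Lsel ha hlim hgrow hEdge
  have hLong := fixedTorusFirst_torusHankelLongitudinal G hG r a Lsel ha hlim hgrow hBdd
  -- clause (i): the blind universal detector along the engine tori (landed); clause (ii): the residual at the same data
  exact ⟨r, a, ha, hlim,
    Summit.QuantumFields.YangMills.Theorems.fixedTorusFirst_someTorusDetector_proof G hG r a Lsel ha hlim hgrow hBdd hLong hN,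
    hS G hG r a Lsel ha hlim hgrow hEdge hN⟩

/-- **`NT` from exactly the route's three open cruxes** (24174, 24178, 27355), via the landed `Assembly`. Implication only. -/
theorem nt_of_cruxes (hB : SomeTorusEdgeBit) (hS : SkewOnSomeTorus) (h2 : FiniteSizeInsensitivity) :
    Summit.QuantumFields.YangMills.Theses.BalabanLadder.NT :=
  Summit.QuantumFields.YangMills.Theorems.fixedTorusFirst_assembly (someTorusFloors_of_cruxes hB hS) h2

end Summit.QuantumFields.YangMills.Cruxes.FixedTorusFirstEngineTori
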